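import Summits.RiemannHypothesis.RiemannHypothesis.Theorems.JensenPolynomialsEffectiveKimLee
import Summits.RiemannHypothesis.RiemannHypothesis.Theorems.JensenPolynomialsLogBandXiSqRightHalfPlane
import HarnessLib

/-!
# Non-real zeros of `ξ₁⁽ⁿ⁾` lie LEFT of the curve `Re w = (1 + √n)(1 + √n + √‖w‖)` (RH-FREE)

RH-FREE (line 1, cell rh-jensen discipline; bears_on LADDER-RH J-P(P3), route «JensenLogBand», the
zone «right of the axis» of the BAND / EDGE lines; nothing here bears on zeros of ζ off the critical
line or the truth of RH — under RH every `ξ₁⁽ⁿ⁾` has only real zeros and the statement is vacuous).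

* `re_lt_of_iteratedDeriv_xiSq_eq_zero` — **every zero `w` of `ξ₁⁽ⁿ⁾ = iteratedDeriv n xiSq` with
  `Im w ≠ 0` satisfies `Re w < (1 + √n)·(1 + √n + √‖w‖)`.** In particular on the closed right
  half-plane the non-real zeros of `ξ₁⁽ⁿ⁾` of modulus `≥ ρ` are confined to the thin region
  `0 ≤ Re w < (1+√n)(1+√n+√‖w‖)` near the imaginary axis (`re_lt_of_iteratedDeriv_xiSq_eq_zero_of_re_nonneg`
  records the consequence `Re w < (1+√n)² + (1+√n)√‖w‖` in the form used by the zone stubs).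

Proof (Ki–Kim backward Jensen chain, as in `EffectiveKimLee.im_eq_zero_of_chain_estimate`, but read
off for the REAL part): for `Im w > 0` take the chain `z₀, …, zₙ = w` of zeros of `ξ₁, …, ξ₁⁽ⁿ⁾`
(`exists_jensen_chain`); its variation is `V ≤ Im z₀·(1+√n)` (`chain_variation_le`), so
`Re w ≤ Re z₀ + V` and `‖z₀‖ ≤ ‖w‖ + V`; the root zero has `Im z₀ ≤ √‖z₀‖`
(`abs_im_le_sqrt_norm_of_xiSq_eq_zero`), whence `Im z₀ ≤ (1+√n) + √‖w‖` and
`V ≤ (1+√n)(1+√n+√‖w‖)`; finally `Re z₀ < 0` because `ξ₁` is zero-free on `Re z ≥ 0`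
(`LogBand.re_neg_of_xiSq_eq_zero`, kernel RH up to height `101`). The case `Im w < 0` follows by
conjugation. Companion of the cell's `xiDerivZerosNearReal` (idea-2: `|Im w| ≤ (1+√n) + √‖w‖`).

Provenance: prover-rh-jensen-eng-2-g4-0, 2026-08-26/27 (pre-work for the stubs `stub_rightOfAxis` /
`stub_edgeRight` of theory g9's LOG-BAND package). AI-produced formalisation; AI review is weaker than
expert review.
-/

noncomputable section

open Complex Filter Metric Set Topology
open scoped ComplexConjugate

set_option linter.dupNamespace false

namespace Summit.RiemannHypothesis.RiemannHypothesis.Theorems.JensenPolynomials.LogBand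

open Literature.NumberTheory.LFunctions Literature.Analysis.Complex
  Literature.Barriers.RiemannHypothesis
  Summit.RiemannHypothesis.RiemannHypothesis.Theorems.JensenPolynomials.EffectiveKimLee

/-- The key estimate for `Im w > 0`: a zero `w` of `ξ₁⁽ⁿ⁾` in the upper half-plane has
`Re w < (1 + √n)(1 + √n + √‖w‖)`. RH-FREE. -/
theorem re_lt_of_iteratedDeriv_xiSq_eq_zero_of_im_pos (n : ℕ) {w : ℂ}
    (hw : iteratedDeriv n xiSq w = 0) (him : 0 < w.im) :
    w.re < (1 + Real.sqrt n) * (1 + Real.sqrt n + Real.sqrt ‖w‖) := by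
  obtain ⟨C, hC⟩ := norm_xiSq_le
  obtain ⟨z, hzn, hzero, hpos, hrel⟩ := exists_jensen_chain differentiable_xiSq
    (by norm_num : (0 : ℝ) ≤ 7 / 8) (by norm_num : (7 / 8 : ℝ) < 2) hC im_xiSq_ofReal
    iteratedDeriv_xiSq_ne_zero n him hw
  set s : ℝ := 1 + Real.sqrt n with hs
  have hs0 : 0 ≤ s := by have := Real.sqrt_nonneg (n : ℝ); rw [hs]; linarith
  -- the variation of the chain
  set V : ℝ := ∑ k ∈ Finset.range n, ‖z k - z (k + 1)‖ with hV
  have hV0 : 0 ≤ V := Finset.sum_nonneg fun k _ ↦ norm_nonneg _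
  have hVle : V ≤ (z 0).im * (1 + Real.sqrt n) := chain_variation_le hpos hrel
  -- `‖z₀ - w‖ ≤ V`
  have hz0w : ‖z 0 - z n‖ ≤ V := by
    have h := dist_le_Ico_sum_dist z (Nat.zero_le n)
    rw [dist_eq_norm] at h
    refine h.trans (le_of_eq ?_)
    rw [hV, Finset.range_eq_Ico]
    simp only [dist_eq_norm]
  rw [hzn] at hz0w
  have hre : w.re - (z 0).re ≤ V := by
    have h1 : |(w - z 0).re| ≤ ‖w - z 0‖ := Complex.abs_re_le_norm _
    rw [Complex.sub_re] at h1
    have h2 : ‖w - z 0‖ = ‖z 0 - w‖ := norm_sub_rev _ _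
    linarith [le_abs_self (w.re - (z 0).re)]
  have hnorm0 : ‖z 0‖ ≤ ‖w‖ + V := by
    calc ‖z 0‖ = ‖(z 0 - w) + w‖ := by rw [sub_add_cancel]
      _ ≤ ‖z 0 - w‖ + ‖w‖ := norm_add_le _ _
      _ ≤ V + ‖w‖ := by linarith
      _ = ‖w‖ + V := add_comm _ _
  -- the root zero: `Re z₀ < 0` and `Im z₀ ≤ √‖z₀‖`
  have hroot : xiSq (z 0) = 0 := by simpa using hzero 0 (Nat.zero_le _)
  have hre0 : (z 0).re < 0 := re_neg_of_xiSq_eq_zero hroot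
  set y : ℝ := (z 0).im with hy
  have hy0 : 0 < y := hpos 0 (Nat.zero_le _)
  have hy1 : y ≤ Real.sqrt (‖w‖ + V) := by
    have h1 : |(z 0).im| ≤ Real.sqrt ‖z 0‖ := abs_im_le_sqrt_norm_of_xiSq_eq_zero hroot
    rw [abs_of_pos hy0] at h1
    exact h1.trans (Real.sqrt_le_sqrt hnorm0)
  have hy2 : y ^ 2 ≤ ‖w‖ + s * y := by
    have h1 : y ^ 2 ≤ ‖w‖ + V := by
      calc y ^ 2 ≤ Real.sqrt (‖w‖ + V) ^ 2 := pow_le_pow_left₀ hy0.le hy1 2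
        _ = ‖w‖ + V := Real.sq_sqrt (by positivity)
    have h2 : V ≤ s * y := by rw [hs, mul_comm]; exact hVle
    linarith
  have hy3 : y ≤ s + Real.sqrt ‖w‖ := le_add_sqrt_of_sq_le hs0 (norm_nonneg w) hy2
  have hVb : V ≤ s * (s + Real.sqrt ‖w‖) := by
    calc V ≤ y * (1 + Real.sqrt n) := hVle
      _ = s * y := by rw [hs, mul_comm]
      _ ≤ s * (s + Real.sqrt ‖w‖) := mul_le_mul_of_nonneg_left hy3 hs0
  -- conclude
  have : w.re ≤ (z 0).re + V := by linarith
  calc w.re ≤ (z 0).re + V := this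
    _ < 0 + s * (s + Real.sqrt ‖w‖) := add_lt_add_of_lt_of_le hre0 hVb
    _ = (1 + Real.sqrt n) * (1 + Real.sqrt n + Real.sqrt ‖w‖) := by rw [hs]; ring

/-- **Every NON-REAL zero `w` of `ξ₁⁽ⁿ⁾` has `Re w < (1 + √n)(1 + √n + √‖w‖)`** (RH-FREE; the
lower half-plane by conjugation, `ξ₁⁽ⁿ⁾(conj w) = conj ξ₁⁽ⁿ⁾(w)`). -/
theorem re_lt_of_iteratedDeriv_xiSq_eq_zero (n : ℕ) {w : ℂ} (hw : iteratedDeriv n xiSq w = 0)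
    (him : w.im ≠ 0) : w.re < (1 + Real.sqrt n) * (1 + Real.sqrt n + Real.sqrt ‖w‖) := by
  rcases lt_or_gt_of_ne him with hneg | hpos
  · have hrefl : iteratedDeriv n xiSq (conj w) = conj (iteratedDeriv n xiSq w) :=
      apply_conj_eq_conj (differentiable_iteratedDeriv_of_entire differentiable_xiSq n)
        (im_iteratedDeriv_ofReal differentiable_xiSq im_xiSq_ofReal n) w
    have h := re_lt_of_iteratedDeriv_xiSq_eq_zero_of_im_pos n (w := conj w)
      (by rw [hrefl, hw, map_zero]) (by simpa using hneg)
    simpa using h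
  · exact re_lt_of_iteratedDeriv_xiSq_eq_zero_of_im_pos n hw hpos

/-- Consequence for the closed right half-plane (the zone «right of the axis»): a non-real zero `w`
of `ξ₁⁽ⁿ⁾` with `Re w ≥ 0` has `Re w < (1 + √n)² + (1 + √n)·√‖w‖`, i.e. it lies in a thin region
along the imaginary axis. RH-FREE. -/
theorem re_lt_of_iteratedDeriv_xiSq_eq_zero_of_re_nonneg (n : ℕ) {w : ℂ}
    (hw : iteratedDeriv n xiSq w = 0) (him : w.im ≠ 0) :
    w.re < (1 + Real.sqrt n) ^ 2 + (1 + Real.sqrt n) * Real.sqrt ‖w‖ := by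
  have h := re_lt_of_iteratedDeriv_xiSq_eq_zero n hw him
  nlinarith [h]

end Summit.RiemannHypothesis.RiemannHypothesis.Theorems.JensenPolynomials.LogBand
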